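import Summits.BirchSwinnertonDyer.BirchSwinnertonDyer.Theorems.EisensteinPrimesAcTwistDeformationCotorsion
import Literature.NumberTheory.EllipticCurves.BigRepModuleShapiroSurjectiveProofs
import Literature.GroupTheory.PadicQuotientSectionProofs
import Summits.BirchSwinnertonDyer.Rank1Residual.X11b.ProcyclicDescentRescaled
import HarnessLib

/-!
# Route `EisensteinPrimes` (rung K5), crux 2 `GoodLatticeBDPValue`, line `halves` v16, stub
# `stub_imprimCorank`, road (A): LOCAL SHAPIRO SURJECTIVITY for the co-induced module at a FINITELY
# DECOMPOSED place — every family of `p^a` cocycles on `ker κ` (one per place of the tower above `w`)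
# is the family of evaluations `h ↦ c(h)(i)`, `i < p^a`, of ONE cocycle of `T ⊗ Λ^*(Ψ⁻¹)` on the
# decomposition group (helper for stmt-BirchSwinnertonDyer-19032)

Cell `bsd-eis`, seat `bsd-line-x1-p1` LEAD g2 (D-0154 row 4); sixth file of road (A). Cell `bsd-stepL`
proved Shapiro's lemma for the co-induced module `M = A ⊗ Λ^*(Ψ⁻¹)` (`bigRep κ ρ`) on a group `G` on which
`κ : G → ℤ_p` is ONTO (`BigRepModule.exists_addEquiv_h1_shapiro`: injectivity M1 + surjectivity M2a
`exists_cocycle_apply_zero_eq_of_section`), and the local INJECTIVITY criterion on a decomposition group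
(`exists_eq_bigRep_sub_comp_iff`: `c|_D` is a coboundary iff all evaluations `d ↦ c(d)(x)` are). For the
`≥` half of the `S`-relaxation identity (surjectivity of the `K_∞`-side global-to-local map) one needs
the local SURJECTIVITY on a decomposition group `D` whose image `κ(D) = p^a ℤ_p` has finite index
(`w` finitely decomposed, `p^a` = the number of places of `K_∞` above `w`): as a `D`-module
`M|_D ≅ ⊕_{i < p^a} M'`, `M'` the co-induced module for the RESCALED character `κ' = p^{-a}κ|_D`
(X11b `ProcyclicDescent.rescale`, onto `ℤ_p`), the `i`-th summand being the smooth functions supported on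
the coset `i + p^a ℤ_p` — [SkinnerUrban2014] (3.1.2.b) "`H¹(k_v, Ind M) ≅ ∏_{w∣v} H¹(E_w, M)`". THIS FILE:

* §1 `glue` bookkeeping (theorems only): `x = (x mod p^a) + p^a · q(x)` (file 5's
  `padicInt_exists_eq_val_add_pow_mul`, `quotient_unique`), and for a family `Φ : Fin (p^a) → M'` the glued smooth `p`-primary function
  `x ↦ Φ_{x mod p^a}(q(x))` (`exists_glue`: a member of `BigRepModule` with the stated values);
* §2 **`exists_cocycle_apply_natCast_eq`** — for `D` compact totally disconnected, `κ : D → ℤ_p` with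
  `p^a ∣ κ(d)` for all `d` and `κ(d₀) = p^a` for some `d₀`, `ρ` a continuous `𝒪`-linear action on the
  discrete `p`-primary `A`, and continuous cocycles `z_i : ker κ → A` (`i < p^a`): there is a continuous
  cocycle `c : D → M` of `bigRep κ ρ` with `c(h)(i) = z_i(h)` for `h ∈ ker κ`, `i < p^a` (M2a for `κ'` and
  a continuous section of `κ'`, summand by summand, glued).

Theorems only; no named fact, no `sorry`. HONEST FRAMING: group cohomology; closes nothing by itself
(`--supports`). References: [SkinnerUrban2014] §3.1.2 ((3.1.2.a)–(3.1.2.b)), Prop. 3.2.3;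
[SerreGaloisCohomology1997] I §2.5; [Washington1997] §13.1 (closed subgroups of `ℤ_p`).
-/

set_option autoImplicit false
set_option linter.dupNamespace false

noncomputable section

open scoped Classical
open Multiplicative
open Literature.NumberTheory.EllipticCurves Literature.NumberTheory.GaloisRepresentations
  Summit.BirchSwinnertonDyer.Rank1Residual.X11b

namespace Summit.BirchSwinnertonDyer.BirchSwinnertonDyer.Theorems.AcTwistDeformation

/-! ## §1 Division with remainder by `p^a` in `ℤ_p` and gluing of smooth functions over the cosets -/

section Glue

variable {p : ℕ} [Fact p.Prime]

/-- The residue `x mod p^a` only depends on `x` modulo `p^a`. [folklore] -/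
theorem toZModPow_eq_of_sub_mem {a : ℕ} {x y : ℤ_[p]} (h : x - y ∈ Ideal.span {(p : ℤ_[p]) ^ a}) :
    PadicInt.toZModPow a x = PadicInt.toZModPow a y := by
  rw [← sub_eq_zero, ← map_sub, ← RingHom.mem_ker, PadicInt.ker_toZModPow]
  exact h

/-- A natural number `i < p^a` is its own residue modulo `p^a` after a shift by a multiple of `p^a`:
`toZModPow a (i + p^a y) = i` with `val = i`. [folklore] -/
theorem val_toZModPow_natCast_add {a : ℕ} {i : ℕ} (hi : i < p ^ a) (y : ℤ_[p]) :
    (PadicInt.toZModPow a ((i : ℤ_[p]) + (p : ℤ_[p]) ^ a * y)).val = i := by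
  have h1 : PadicInt.toZModPow a ((i : ℤ_[p]) + (p : ℤ_[p]) ^ a * y) = (i : ZMod (p ^ a)) := by
    have hker : (p : ℤ_[p]) ^ a * y ∈ RingHom.ker (PadicInt.toZModPow a) := by
      rw [PadicInt.ker_toZModPow]
      exact Ideal.mul_mem_right _ _ (Ideal.mem_span_singleton_self _)
    rw [map_add, map_natCast, (RingHom.mem_ker).mp hker, add_zero]
  rw [h1, ZMod.val_natCast, Nat.mod_eq_of_lt hi]

/-- The quotient in `x = i + p^a b` is unique (`ℤ_p` is a domain, `p ≠ 0`). [folklore] -/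
theorem quotient_unique {a : ℕ} {i : ℤ_[p]} {b b' : ℤ_[p]}
    (h : i + (p : ℤ_[p]) ^ a * b = i + (p : ℤ_[p]) ^ a * b') : b = b' := by
  have hp : (p : ℤ_[p]) ^ a ≠ 0 := pow_ne_zero _ (by exact_mod_cast (Fact.out : p.Prime).ne_zero)
  exact mul_left_cancel₀ hp (add_left_cancel h)

variable {𝒪 : Type*} [CommRing 𝒪] {A : Type*} [AddCommGroup A] [Module 𝒪 A]

/-- **Gluing smooth `p`-primary functions over the cosets of `p^a ℤ_p`.** For a family
`Φ : Fin (p^a) → M'` of smooth `p`-primary functions there is a smooth `p`-primary `Ψ` with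
`Ψ(i + p^a y) = Φ_i(y)` for all `i < p^a`, `y ∈ ℤ_p` (`Ψ(x) = Φ_{x mod p^a}((x − x mod p^a)/p^a)`; levels
go up by `a`). [cite: SkinnerUrban2014, §3.1.2 ((3.1.2.b): `Ind M ≅ ⊕` over the places above `v`)] -/
theorem exists_glue (a : ℕ) (Φ : Fin (p ^ a) → BigRepModule 𝒪 p A) :
    ∃ Ψ : BigRepModule 𝒪 p A, ∀ (i : Fin (p ^ a)) (y : ℤ_[p]),
      Ψ ((i : ℕ) + (p : ℤ_[p]) ^ a * y) = Φ i y := by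
  -- quotient function
  choose q hq using fun x : ℤ_[p] ↦ padicInt_exists_eq_val_add_pow_mul a x
  have hlt : ∀ x : ℤ_[p], (PadicInt.toZModPow a x).val < p ^ a := fun x ↦ ZMod.val_lt _
  let r : ℤ_[p] → Fin (p ^ a) := fun x ↦ ⟨(PadicInt.toZModPow a x).val, hlt x⟩
  let F : ℤ_[p] → A := fun x ↦ Φ (r x) (q x)
  -- a common level and a common torsion exponent for the finite family
  choose n hn using fun i : Fin (p ^ a) ↦ (Φ i).exists_level
  choose k hk using fun i : Fin (p ^ a) ↦ (Φ i).exists_torsion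
  have hF : F ∈ bigRepSubmodule 𝒪 p A := by
    refine ⟨⟨Finset.univ.sup n + a, fun x x' hxx' ↦ ?_⟩, ⟨Finset.univ.sup k, fun x ↦ ?_⟩⟩
    · -- same residue, congruent quotients
      have ha : x - x' ∈ Ideal.span {(p : ℤ_[p]) ^ a} :=
        Ideal.span_singleton_le_span_singleton.mpr (pow_dvd_pow _ (Nat.le_add_left a _)) hxx'
      have hr : r x = r x' := Fin.ext (by
        change (PadicInt.toZModPow a x).val = (PadicInt.toZModPow a x').val
        rw [toZModPow_eq_of_sub_mem ha])
      have hqq : q x - q x' ∈ Ideal.span {(p : ℤ_[p]) ^ (Finset.univ.sup n)} := by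
        obtain ⟨t, ht⟩ := Ideal.mem_span_singleton'.mp hxx'
        have hval : ((PadicInt.toZModPow a x).val : ℤ_[p]) = (PadicInt.toZModPow a x').val := by
          rw [toZModPow_eq_of_sub_mem ha]
        have e1 : (p : ℤ_[p]) ^ a * (q x - q x') = x - x' := by
          conv_rhs => rw [hq x, hq x']
          rw [hval]; ring
        have hp : (p : ℤ_[p]) ^ a ≠ 0 := pow_ne_zero _ (by exact_mod_cast (Fact.out : p.Prime).ne_zero)
        refine Ideal.mem_span_singleton'.mpr ⟨t, mul_left_cancel₀ hp ?_⟩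
        rw [e1, ← ht]; ring
      change Φ (r x) (q x) = Φ (r x') (q x')
      rw [hr]
      exact hn (r x') _ _ (Ideal.span_singleton_le_span_singleton.mpr
        (pow_dvd_pow _ (Finset.le_sup (Finset.mem_univ _))) hqq)
    · change p ^ (Finset.univ.sup k) • Φ (r x) (q x) = 0
      obtain ⟨m, hm⟩ := Nat.exists_eq_add_of_le (Finset.le_sup (f := k) (Finset.mem_univ (r x)))
      rw [hm, pow_add, mul_comm, mul_smul, hk, smul_zero]
  refine ⟨BigRepModule.mk F hF, fun i y ↦ ?_⟩
  rw [BigRepModule.mk_apply]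
  change Φ (r _) (q _) = Φ i y
  have hri : r ((i : ℕ) + (p : ℤ_[p]) ^ a * y) = i :=
    Fin.ext (val_toZModPow_natCast_add i.2 y)
  have hqi : q ((i : ℕ) + (p : ℤ_[p]) ^ a * y) = y := by
    have e := hq ((i : ℕ) + (p : ℤ_[p]) ^ a * y)
    rw [val_toZModPow_natCast_add i.2 y] at e
    exact (quotient_unique e).symm
  rw [hri, hqi]

end Glue

/-! ## §2 Local Shapiro surjectivity on a finitely decomposed decomposition group -/

section Local

variable {𝒪 : Type} [CommRing 𝒪] [TopologicalSpace 𝒪] {p : ℕ} [Fact p.Prime]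
  {A : Type} [AddCommGroup A] [Module 𝒪 A] [TopologicalSpace A] [DiscreteTopology A]
  {D : Type} [Group D] [TopologicalSpace D] [IsTopologicalGroup D] [CompactSpace D]
  [TotallyDisconnectedSpace D] [TopologicalSpace (PowerSeries 𝒪)]
  (κ : D →ₜ* Multiplicative ℤ_[p]) (ρ : ContinuousRep D 𝒪 A)

omit [IsTopologicalGroup D] [CompactSpace D] [TotallyDisconnectedSpace D] in
/-- `κ(d) = p^a · κ'(d)` for the rescaled character `κ' = rescale κ a`. [cite: Washington1997, §13.1] -/
theorem toAdd_eq_pow_mul_rescale {a : ℕ} (hdiv : ∀ d : D, (p : ℤ_[p]) ^ a ∣ (κ d).toAdd) (d : D) :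
    (κ d).toAdd = (p : ℤ_[p]) ^ a * (ProcyclicDescent.rescale κ a hdiv d).toAdd := by
  obtain ⟨c, hc⟩ := hdiv d
  rw [ProcyclicDescent.rescale_eq_of_eq κ a hdiv d c hc, toAdd_ofAdd, hc]

omit [CompactSpace D] [TotallyDisconnectedSpace D] in
/-- **The `i`-th coset summand**: for a smooth `p`-primary `Φ`, the function supported on `i + p^a ℤ_p`
with `x = i + p^a y ↦ Φ(y)` — glued from the family `(0, …, Φ, …, 0)` — is `D`-EQUIVARIANT from the
co-induced module of the rescaled `κ'` to that of `κ`: `d · Ψ = (d ·' Φ)`glued (`κ d = p^a κ' d` moves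
`i + p^a y` to `i + p^a (y − κ' d)`), and vanishes at the other representatives `j ≠ i`.
[cite: SkinnerUrban2014, §3.1.2 ((3.1.2.b))] -/
theorem exists_summand {a : ℕ} (hdiv : ∀ d : D, (p : ℤ_[p]) ^ a ∣ (κ d).toAdd) (i : Fin (p ^ a))
    (Φ : BigRepModule 𝒪 p A) :
    ∃ Ψ : BigRepModule 𝒪 p A,
      (∀ (j : Fin (p ^ a)) (y : ℤ_[p]), Ψ ((j : ℕ) + (p : ℤ_[p]) ^ a * y) = if j = i then Φ y else 0) ∧
      ∀ d : D, ∃ Ψ' : BigRepModule 𝒪 p A,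
        (∀ (j : Fin (p ^ a)) (y : ℤ_[p]), Ψ' ((j : ℕ) + (p : ℤ_[p]) ^ a * y) =
          if j = i then bigRep (ProcyclicDescent.rescale κ a hdiv) ρ d Φ y else 0) ∧
        bigRep κ ρ d Ψ = Ψ' := by
  obtain ⟨Ψ, hΨ⟩ := exists_glue (𝒪 := 𝒪) (A := A) a (fun j ↦ if j = i then Φ else 0)
  have hΨ' : ∀ (j : Fin (p ^ a)) (y : ℤ_[p]), Ψ ((j : ℕ) + (p : ℤ_[p]) ^ a * y) = if j = i then Φ y else 0 := by
    intro j y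
    rw [hΨ]
    split_ifs <;> rfl
  refine ⟨Ψ, hΨ', fun d ↦ ⟨bigRep κ ρ d Ψ, fun j y ↦ ?_, rfl⟩⟩
  rw [bigRep_apply_apply, toAdd_eq_pow_mul_rescale κ hdiv d,
    show (j : ℕ) + (p : ℤ_[p]) ^ a * y - (p : ℤ_[p]) ^ a * (ProcyclicDescent.rescale κ a hdiv d).toAdd =
      (j : ℕ) + (p : ℤ_[p]) ^ a * (y - (ProcyclicDescent.rescale κ a hdiv d).toAdd) by ring,
    hΨ', bigRep_apply_apply]
  split_ifs
  · rfl
  · rw [map_zero]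

/-- **LOCAL SHAPIRO SURJECTIVITY.** Let `D` be a compact totally disconnected group, `κ : D → ℤ_p`
continuous with `p^a ∣ κ(d)` for every `d` and `κ(d₀) = p^a` for some `d₀` (image EXACTLY `p^a ℤ_p`:
a finitely decomposed place with `p^a` places above it), `ρ` a continuous `𝒪`-linear action of `D` on
the discrete `p`-primary `A`. For every family `z_i : ker κ → A` (`i < p^a`) of continuous crossed
homomorphisms there is a continuous crossed homomorphism `c : D → A ⊗ Λ^*(Ψ⁻¹)` (`bigRep κ ρ`) whose
evaluations at the representatives are the `z_i`: `c(h)(i) = z_i(h)` for `h ∈ ker κ`. Proof: `ker κ =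
ker κ'` for the onto `κ' = p^{-a}κ`; M2a (`exists_cocycle_apply_zero_eq_of_section`, with a continuous
section of `κ'` from `exists_continuousMonoidHom_section_padicInt`) gives `κ'`-cocycles `c_i` with
`c_i(h)(0) = z_i(h)`; glue `c = Σ_i (c_i)_{on the coset i}`.
[cite: SkinnerUrban2014, §3.1.2 ((3.1.2.a)–(3.1.2.b)) and Prop. 3.2.3] [cite: SerreGaloisCohomology1997, I §2.5] -/
theorem exists_cocycle_apply_natCast_eq (hA : ∀ x : A, ∃ k : ℕ, p ^ k • x = 0) {a : ℕ}
    (hdiv : ∀ d : D, (p : ℤ_[p]) ^ a ∣ (κ d).toAdd) {d₀ : D} (hd₀ : (κ d₀).toAdd = (p : ℤ_[p]) ^ a)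
    (z : Fin (p ^ a) → (κ : D →* Multiplicative ℤ_[p]).ker → A) (hzc : ∀ i, Continuous (z i))
    (hz : ∀ (i) (h₁ h₂ : (κ : D →* Multiplicative ℤ_[p]).ker), z i (h₁ * h₂) = z i h₁ + ρ (h₁ : D) (z i h₂)) :
    ∃ c : D → BigRepModule 𝒪 p A, Continuous c ∧
      (∀ g h : D, c (g * h) = c g + bigRep κ ρ g (c h)) ∧
      ∀ (i : Fin (p ^ a)) (h : (κ : D →* Multiplicative ℤ_[p]).ker), c (h : D) ((i : ℕ) : ℤ_[p]) = z i h := by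
  set κ' := ProcyclicDescent.rescale κ a hdiv with hκ'
  -- a continuous section of the onto `κ'`
  have hγ' : κ' d₀ = ofAdd 1 := ProcyclicDescent.rescale_eq_one κ a hdiv d₀ hd₀
  obtain ⟨σ, hσ⟩ := Literature.GroupTheory.exists_continuousMonoidHom_section_padicInt κ' d₀ hγ'
  have hker : ∀ g : D, g ∈ (κ : D →* Multiplicative ℤ_[p]).ker ↔ κ' g = 1 := by
    intro g
    have := SetLike.ext_iff.mp (ProcyclicDescent.kerK_rescale κ a hdiv) g
    exact this.symm
  -- M2a, summand by summand
  have hM2a : ∀ i : Fin (p ^ a), ∃ c : D → BigRepModule 𝒪 p A, Continuous c ∧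
      (∀ g h : D, c (g * h) = c g + bigRep κ' ρ g (c h)) ∧
      ∀ h : (κ : D →* Multiplicative ℤ_[p]).ker, c (h : D) 0 = z i h := fun i ↦
    BigRepModule.exists_cocycle_apply_zero_eq_of_section (κ := κ') (ρ := ρ) (s := fun x ↦ σ (ofAdd x))
      (σ.continuous_toFun.comp continuous_ofAdd) (fun x ↦ hσ (ofAdd x)) (by
        rw [ofAdd_zero, map_one]) hA hker (z i) (hzc i) (hz i)
  choose c hcont hcoc hc0 using hM2a
  -- glue the summands
  have hsum : ∀ i : Fin (p ^ a), ∃ ι : BigRepModule 𝒪 p A →+ BigRepModule 𝒪 p A,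
      (∀ (Φ : BigRepModule 𝒪 p A) (j : Fin (p ^ a)) (y : ℤ_[p]),
        ι Φ ((j : ℕ) + (p : ℤ_[p]) ^ a * y) = if j = i then Φ y else 0) ∧
      ∀ (d : D) (Φ : BigRepModule 𝒪 p A), bigRep κ ρ d (ι Φ) = ι (bigRep κ' ρ d Φ) := by
    intro i
    choose Ψ hΨ hΨd using fun Φ : BigRepModule 𝒪 p A ↦ exists_summand κ ρ hdiv i Φ
    -- a glued function is determined by its values on the cosets
    have hext : ∀ Ψ₁ Ψ₂ : BigRepModule 𝒪 p A,
        (∀ (j : Fin (p ^ a)) (y : ℤ_[p]), Ψ₁ ((j : ℕ) + (p : ℤ_[p]) ^ a * y) = Ψ₂ ((j : ℕ) + (p : ℤ_[p]) ^ a * y)) →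
        Ψ₁ = Ψ₂ := by
      intro Ψ₁ Ψ₂ h
      ext x
      obtain ⟨b, hb⟩ := padicInt_exists_eq_val_add_pow_mul a x
      rw [hb]
      exact h ⟨_, ZMod.val_lt _⟩ b
    refine ⟨{ toFun := Ψ, map_zero' := ?_, map_add' := fun Φ₁ Φ₂ ↦ ?_ }, fun Φ j y ↦ hΨ Φ j y, fun d Φ ↦ ?_⟩
    · refine hext _ _ fun j y ↦ ?_
      rw [hΨ, BigRepModule.zero_apply, BigRepModule.zero_apply, ite_self]
    · refine hext _ _ fun j y ↦ ?_
      rw [hΨ, BigRepModule.add_apply, BigRepModule.add_apply, hΨ, hΨ]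
      split_ifs <;> simp
    · obtain ⟨Ψ', hΨ', hd⟩ := hΨd Φ d
      change bigRep κ ρ d (Ψ Φ) = Ψ (bigRep κ' ρ d Φ)
      rw [hd]
      exact hext _ _ fun j y ↦ by rw [hΨ', hΨ]
  choose ι hι hιeq using hsum
  refine ⟨fun g ↦ ∑ i, ι i (c i g), ?_, fun g h ↦ ?_, fun i h ↦ ?_⟩
  · exact continuous_finsetSum _ fun i _ ↦
      (continuous_of_discreteTopology (f := fun Φ : BigRepModule 𝒪 p A ↦ ι i Φ)).comp (hcont i)
  · rw [map_sum, ← Finset.sum_add_distrib]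
    exact Finset.sum_congr rfl fun i _ ↦ by rw [hcoc, map_add, hιeq]
  · have h0 : ((i : ℕ) : ℤ_[p]) = (i : ℕ) + (p : ℤ_[p]) ^ a * 0 := by rw [mul_zero, add_zero]
    -- evaluation at a point is additive
    let ev : BigRepModule 𝒪 p A →+ A :=
      { toFun := fun Φ ↦ Φ ((i : ℕ) + (p : ℤ_[p]) ^ a * 0), map_zero' := rfl, map_add' := fun _ _ ↦ rfl }
    rw [h0, show (∑ j, ι j (c j (h : D))) ((i : ℕ) + (p : ℤ_[p]) ^ a * 0) = ev (∑ j, ι j (c j (h : D)))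
      from rfl, map_sum]
    change ∑ j, ι j (c j (h : D)) ((i : ℕ) + (p : ℤ_[p]) ^ a * 0) = _
    rw [Finset.sum_eq_single i (fun j _ hji ↦ by rw [hι, if_neg (Ne.symm hji)]) (fun h ↦ (h (Finset.mem_univ i)).elim),
      hι, if_pos rfl, hc0]

end Local

end Summit.BirchSwinnertonDyer.BirchSwinnertonDyer.Theorems.AcTwistDeformation

end
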